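import Summits.QuantumFields.YangMills.Theorems.FluctuationComparisonRegPrIntLOrganTangentAPackageFromHeight
import Summits.QuantumFields.YangMills.Theorems.FluctuationComparisonRegPrIntLOrganTangentRegularE2EV26
import HarnessLib

/-!
# ROW VER∘ `FibreMeanVersionCan` OF LINE g25-1 «organ_tangent» (v2.6, R-CUT-χ token) HOLDS — THE VERSION ROAD CLOSED IN `Theorems/`, DEFINITION-FREE

Cell `ym3-torus` (YM ladder rung R3 = continuum `SU(2)` Yang–Mills on the three-torus — a RUNG, NOT d = 4, NOT infinite volume, NOT a mass gap, NOT Clay).  Width seat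
`ym-ust-20520-w4` (gen 21), pen named by LEAD-20520 w3 g23 WORD №7 (ii) («the closing composition … yours by lineage»); `--supports stmt-QuantumFields-20520 --as helper`,
count-neutral, definition-free, default heartbeats; no registry, binder or `Lines/` edit; the registered skeleton `Lines/semiclassical_s2beta.lean` v11.4 and its five stubs are
untouched (0∕5, ★★OWNER RULING №36); no claim on the crux.

WHAT THIS IS.  ★★★`fibreMeanVersionCan_holds` — the text of row VER∘ `FibreMeanVersionCan` of tree `Cruxes/FluctuationComparisonRegPrIntL/Lines/organ_tangent.lean` v2.6
76720d4c18480548 (stub `stub_fibreMeanVersion` there), with its cutoff `sfCut θ U` written as the v2.6 token `∏ p, max 0 (min 1 ((24∕25·θ − dist1)∕((24∕25 − 1∕2)·θ)))`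
(✓p781986's convention), PROVED OUTRIGHT: in the regime `0 < γ ≤ 1, 0 < b₀, 0 < p₀`, from a height `jV(F, γ, b₀, p₀)` on, in O1 v17.2's frame (ν-runs, `K ≤ K'`, anchor
`[Ts, T]`, SMOOTH cut below `Ts`, finite towers, membership modulo constants), for EVERY disintegration `σ` of product Haar along `descend`, the χ-localised fibre mean of the fine
discrepancy has a window-continuous version `m` with the a.e. integral identity.  PROOF = two tree theorems composed: w5 g21's ✓(L8)
`…OrganTangentAPackageFromHeight.exists_height_regularSmallFieldDisintegration` — the (A)-PACKAGE at the window constant `24∕25` (one Markov disintegration `σ₀`, a finite fibre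
family `lam` with (A1) window-continuity, (A2) positive `24∕25`-window mass, (A3) `∫ f dσ₀_V = c(V)·∫ f dlam_V` a.e.) HOLDS for EVERY `F : T3Family` from a height, UNCONDITIONALLY
(= ✓(L7) `oneBondLaw` (w5: the per-bond one-variable inverse LAW of Bałaban's averaging in its private coordinates, Stage 1∕2) ∘ ✓`…OrganTangentAPackageAtDescend` (w4, p784601:
TRIc ∘ DescendSection ∘ MASSc ∘ (β′), σ₀ constructed; LEAD w3 g22∕g23's fibred-chart road, px12 g19's spread lift)) — fed into ✓`…OrganTangentRegularE2EV26.fibreMeanVersion_of_regular`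
(w4, p784599 = LEAD's KNITc∕TOOLSc + DOORFIT-VER25 (i), def-free): (A) from a height ⟹ VER∘.  The `hA` binder of the latter IS (L8)'s conclusion under `∀ F γ b₀ p₀, regime →`,
token for token, so the proof is one application.

WHAT IT IS NOT.  VER∘ is ONE of the three rows of LINE g25-1's cut of the one-step organ O1 (`O1 ⟸ VER∘ ∧ LIN∘ ∧ JEN∘`, ✓T-LIFT-1′ p782786); LIN∘ and JEN∘ (and O1's
single-step clause, under re-typing to v18 per ★★OWNER g39 RULING №58) remain OPEN rows; the crux `FluctuationComparisonRegPrIntL` (20520), the package's S-stubs and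
`YM3TorusSU2` are NOT proved; nothing of Bałaban's renormalisation-group ANALYSIS is asserted or proved here — VER∘ is measure-geometric (disintegration, co-area, the
one-bond chart), which is exactly why it closed first.  No summit ∕ sub-problem statement is proved; rung R3 = SU(2) YM₃ on T³ — NOT d = 4, NOT infinite volume, NOT a mass gap,
NOT Clay; the Yang–Mills mass gap is NOT proved by any of this.  All credit for the mathematics: LEAD w3 g22∕g23 (the (A)-package, TOOLS∕KNIT∕BRIDGE∕TRI∕MASS and their generic-cut
editions, DescendSection, DOORFIT-VER25), w5 g21 ((B1′) Stage 1∕2: OneBondFamily∕Inverse∕LocalInverse∕Geometry∕AtDescend∕Data∕Law, (L8)), px12 g19 ((B4), (β′)), ideator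
g25∕g26 (the rows and the R-CUT-χ token); this seat composed.
[cite: Balaban1985Averaging, (10)-(13) p.19; Balaban1987RG1, (0.4) p.253, (0.13) p.254, (0.18) p.255, (2.10) p.267; Balaban1985UV3, (42)-(44) pp.266-267]
-/

set_option autoImplicit false

noncomputable section

namespace Summit.QuantumFields.YangMills.Theorems.FluctuationComparisonRegPrIntLOrganTangentVersionClosed

open MeasureTheory Filter Topology
open scoped ENNReal
open Literature.MathematicalPhysics.QuantumFieldTheory.Balaban1983to89 T3ContinuumYM3Torus T3NestedUnitLaws
  T3UnitLawDensityEML T4Continuum BalabanUVClass T3UnitScaleTilt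

/-- ★★★ **ROW VER∘ HOLDS** — `FibreMeanVersionCan` of LINE g25-1 «organ_tangent» v2.6 (tree text, cutoff inlined as the R-CUT-χ token) PROVED: ✓(L8)
`exists_height_regularSmallFieldDisintegration` (the (A)-package from a height, every family, unconditional) fed into ✓`fibreMeanVersion_of_regular` ((A) ⟹ VER∘).
[cite: Balaban1985Averaging, (10)-(13) p.19; Balaban1987RG1, (0.13) p.254 and (2.10) p.267] -/
theorem fibreMeanVersionCan_holds :
    ∀ (F : T3Family) (γ b₀ p₀ : ℝ), 0 < γ → γ ≤ 1 → 0 < b₀ → 0 < p₀ → ∃ jV : ℕ, ∀ (j₀ : ℕ) (prm : ℕ → ClassParams) (η : ℕ → ℝ), ∀ (ν : ℕ → (j : ℕ) → MeasureTheory.Measure (GaugeField (F.P j) 0 ↥(Matrix.specialUnitaryGroup (Fin 2) ℂ))), (∀ K, ν K K = T4GenFunBounds.gibbsMeasure (F.P K) ((F.scheme ℰp γ).β K)) → (∀ K j, j < K → ν K j = Measure.map (descend F ℰp j) (ν K (j + 1))) → ∀ (K K' : ℕ), K ≤ K' → ∀ (Ts T : ℕ), Ts < T → T ≤ K → ∀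 (μ μ' : ((j : ℕ) → MeasureTheory.Measure (GaugeField (F.P j) 0 ↥(Matrix.specialUnitaryGroup (Fin 2) ℂ)))) (ρ ρ' : ((j : ℕ) → GaugeField (F.P j) 0 ↥(Matrix.specialUnitaryGroup (Fin 2) ℂ) → ℝ)), (∀ j : ℕ, Ts ≤ j → j ≤ T → μ j = ν K j ∧ μ' j = ν K' j) → (∀ j : ℕ, j < Ts → μ j = Measure.map (descend F ℰp j) ((μ (j + 1)).withDensity (fun U => ENNReal.ofReal ((∏ p : Plaq (F.P (j + 1)) 0, max 0 (min 1 ((24 / 25 * θBal F.L γ b₀ p₀ (j + 1) - dist1 (GaugeField.plaqHol U p)) / ((24 / 25 - 1 / 2) * θBal F.L γ b₀ p₀ (j + 1)))))))) ∧ μ' j = Measure.map (descend F ℰp j) ((μ' (j + 1)).withDensity (fun U => ENNReal.ofReal ((∏ p : Plaq (F.P (j + 1)) 0, max 0 (min 1 ((24 / 25 * θBal F.L γ b₀ p₀ (j + 1) - dist1 (GaugeField.plaqHol U p)) / ((24 / 25 - 1 / 2) * θBal F.L γ b₀ p₀ (j + 1))))))))) → (∀ j : ℕ, Ts ≤ j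 → j < T → μ j = Measure.map (descend F ℰp j) (μ (j + 1)) ∧ μ' j = Measure.map (descend F ℰp j) (μ' (j + 1))) → (∀ j : ℕ, j ≤ T → IsFiniteMeasure (μ j) ∧ IsFiniteMeasure (μ' j)) → (∀ j : ℕ, j₀ ≤ j → j ≤ T → ((∀ U, PlaqSmall (θBal F.L γ b₀ p₀ j) U → 0 < ρ j U ∧ 0 < ρ' j U) ∧ μ j = (fieldMeasure _ _ _).withDensity (fun U => ENNReal.ofReal (ρ j U)) ∧ μ' j = (fieldMeasure _ _ _).withDensity (fun U => ENNReal.ofReal (ρ' j U)) ∧ (∃ κ : ℝ, MemAtHeight F ℰp j (prm j) (fun U => Real.exp κ * ρ j U)) ∧ (∃ κ : ℝ, MemAtHeight F ℰp j (prm j) (fun U => Real.exp κ * ρ' j U)) ∧ μ j {U | ¬ PlaqSmall (θBal F.L γ b₀ p₀ j) U} ≤ ENNReal.ofReal (η j) ∧ μ' j {U | ¬ PlaqSmall (θBal F.L γ b₀ p₀ j) U} ≤ ENNReal.ofReal (η j) ∧ (ContinuousOn (ρ j) {U | PlaqSmall (θBal F.L γ b₀ p₀ j) U} ∧ ContinuousOn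 (ρ' j) {U | PlaqSmall (θBal F.L γ b₀ p₀ j) U}))) → ∀ (j : ℕ), jV ≤ j → j₀ ≤ j → j + 1 ≤ T → ∀ (σ : ProbabilityTheory.Kernel (GaugeField (F.P j) 0 ↥(Matrix.specialUnitaryGroup (Fin 2) ℂ)) (GaugeField (F.P (j + 1)) 0 ↥(Matrix.specialUnitaryGroup (Fin 2) ℂ))), ProbabilityTheory.IsMarkovKernel σ → (Measure.map (descend F ℰp j) (fieldMeasure (F.P (j + 1)) 0 ↥(Matrix.specialUnitaryGroup (Fin 2) ℂ))).bind ⇑σ = fieldMeasure (F.P (j + 1)) 0 ↥(Matrix.specialUnitaryGroup (Fin 2) ℂ) → (∀ᵐ V ∂(Measure.map (descend F ℰp j) (fieldMeasure (F.P (j + 1)) 0 ↥(Matrix.specialUnitaryGroup (Fin 2) ℂ))), ∀ᵐ U ∂(σ V), descend F ℰp j U = V) → ∃ (m : GaugeField (F.P j) 0 ↥(Matrix.specialUnitaryGroup (Fin 2) ℂ) → ℝ), ContinuousOn m {V | PlaqSmall (θBal F.L γ b₀ p₀ j) V} ∧ (∀ᵐ V ∂(fieldMeasure (F.P j) 0 ↥(Matrix.specialUnitaryGroup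 (Fin 2) ℂ)), PlaqSmall (θBal F.L γ b₀ p₀ j) V → MeasureTheory.Integrable (fun U => (∏ p : Plaq (F.P (j + 1)) 0, max 0 (min 1 ((24 / 25 * θBal F.L γ b₀ p₀ (j + 1) - dist1 (GaugeField.plaqHol U p)) / ((24 / 25 - 1 / 2) * θBal F.L γ b₀ p₀ (j + 1))))) * (Real.log (ρ (j + 1) U) - Real.log (ρ' (j + 1) U)) * ρ' (j + 1) U) (σ V) ∧ m V = (∫ U, (∏ p : Plaq (F.P (j + 1)) 0, max 0 (min 1 ((24 / 25 * θBal F.L γ b₀ p₀ (j + 1) - dist1 (GaugeField.plaqHol U p)) / ((24 / 25 - 1 / 2) * θBal F.L γ b₀ p₀ (j + 1))))) * (Real.log (ρ (j + 1) U) - Real.log (ρ' (j + 1) U)) * ρ' (j + 1) U ∂(σ V)) / (∫ U, (∏ p : Plaq (F.P (j + 1)) 0, max 0 (min 1 ((24 / 25 * θBal F.L γ b₀ p₀ (j + 1) - dist1 (GaugeField.plaqHol U p)) / ((24 / 25 - 1 / 2) * θBal F.L γ b₀ p₀ (j + 1))))) * ρ' (j + 1) U ∂(σ V))) :=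
  FluctuationComparisonRegPrIntLOrganTangentRegularE2EV26.fibreMeanVersion_of_regular
    fun F γ b₀ p₀ hγ hγ1 hb₀ hp₀ =>
      FluctuationComparisonRegPrIntLOrganTangentAPackageFromHeight.exists_height_regularSmallFieldDisintegration F γ b₀ p₀ hγ hγ1 hb₀ hp₀

end Summit.QuantumFields.YangMills.Theorems.FluctuationComparisonRegPrIntLOrganTangentVersionClosed

end
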